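import Summits.Ventures.PercRepro.LemmaBAbstract
import Summits.Ventures.PercRepro.SMC

/-!
# Single-merge maps with three crossing-pair types: singletons are `⊥`, co-singletons are `⊤`

A monotone map `c : Config S → Setoid (Fin 4)` is **single-merge** when along every cube edge
its value stays or performs one block merge (`IsSingleMerge`): this is what every percolation
map of a marked multigraph does (opening one edge merges at most two blocks of the mark
partition), and what the abstract SAT/SMT instances of Lemma B do NOT do (`HOME/proofs/P4-components.md`
§9–§10). When crossing pairs of all three types `{x_i, x_j}` occur:

* `cell_singleConfig_eq_bot`: every singleton configuration has cell `⊥` — an `r`-singleton would force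
  every configuration containing it to be `≥ r`, but the crossing pair of the type not involving
  that merge has the coordinate in one of its two members;
* `cell_compl_singleConfig_eq_top`: every co-singleton has cell `⊤` — it contains, from each of the three
  pairs, the member avoiding the coordinate, two of which lie in different crossing cells;
* `card_add_one_le_topBotCount`: hence `topBotCount c ≥ |S| + 1`.

These are the first two steps of the dimension lemma «single merge ∧ three types ⇒ d ≥ 8»
(§10 (a), (b)); (c)–(d) are left to paper.
-/

namespace PercRepro

open Finset

section SingleMerge

variable {S : Type*} [Fintype S] [DecidableEq S]

/-- The singleton configuration `{e}`. -/
def singleConfig (e : S) : Config S := fun x => decide (x = e)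

/-- **Single-merge map**: along every cube edge the cell stays or performs one block merge. -/
def SingleMergeMap (c : Config S → Setoid (Fin 4)) : Prop :=
  ∀ (ω : Config S) (e : S), ω e = false →
    c ω = c (Function.update ω e true) ∨ IsSingleMerge (c ω) (c (Function.update ω e true))

/-- **All three crossing-pair types occur**: for every ordered pair of distinct crossing cells
there is an antipodal pair carrying them. -/
def ThreeTypes (c : Config S → Setoid (Fin 4)) : Prop :=
  ∀ i j : Fin 3, i ≠ j → ∃ ω : Config S, c ω = cross4 i ∧ c ωᶜ = cross4 j

omit [Fintype S] in
/-- The singleton configuration at `e` is open exactly at `e`. -/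
theorem singleConfig_apply (e x : S) : singleConfig e x = decide (x = e) := rfl

omit [Fintype S] in
/-- Opening one coordinate of the empty configuration gives the singleton configuration. -/
theorem update_bot_eq_singleConfig (e : S) : Function.update (⊥ : Config S) e true = singleConfig e := by
  funext x
  by_cases h : x = e
  · subst h; simp [singleConfig]
  · simp [singleConfig, h]

omit [Fintype S] [DecidableEq S] in
/-- The empty configuration is closed everywhere. -/
theorem config_bot_apply (e : S) : (⊥ : Config S) e = false := rfl

omit [Fintype S] in
/-- `{e} ≤ ω` iff `ω e = true`. -/
theorem singleConfig_le_iff (e : S) (ω : Config S) : singleConfig e ≤ ω ↔ ω e = true := by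
  constructor
  · intro h
    have := h e
    simp only [singleConfig, decide_true] at this
    revert this; cases ω e <;> simp
  · intro h x
    by_cases hx : x = e
    · subst hx; simp [singleConfig, h]
    · simp [singleConfig, hx]

omit [Fintype S] in
/-- `ω ≤ {e}ᶜ` iff `ω e = false`. -/
theorem le_compl_singleConfig_iff (e : S) (ω : Config S) : ω ≤ (singleConfig e)ᶜ ↔ ω e = false := by
  constructor
  · intro h
    have := h e
    simp only [singleConfig, Pi.compl_apply, decide_true] at this
    revert this; cases ω e <;> simp
  · intro h x
    by_cases hx : x = e
    · subst hx; simp [singleConfig, h]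
    · simp [singleConfig, hx]

/-- Every pair `{i, j}` of distinct indices is a block of exactly one crossing partition. -/
theorem cross4_pair_unique (i j : Fin 4) (hij : i ≠ j) :
    ∃ k : Fin 3, cross4 k i j ∧ ∀ k' : Fin 3, cross4 k' i j → k' = k := by
  simp only [cross4_rel]
  revert i j
  decide

omit [Fintype S] [DecidableEq S] in
/-- The bottom configuration has cell `⊥` as soon as one crossing pair exists. -/
theorem cell_bot_eq_bot (c : Config S → Setoid (Fin 4)) (hc : Monotone c) (h3 : ThreeTypes c) :
    c ⊥ = ⊥ := by
  obtain ⟨ω, h1, h2⟩ := h3 0 1 (by decide)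
  apply le_bot_iff.1
  calc c ⊥ ≤ c ω ⊓ c ωᶜ := le_inf (hc bot_le) (hc bot_le)
    _ = cross4 0 ⊓ cross4 1 := by rw [h1, h2]
    _ = ⊥ := cross4_inf_eq_bot (by decide)

omit [Fintype S] in
/-- **(a) Singletons have cell `⊥`.** -/
theorem cell_singleConfig_eq_bot (c : Config S → Setoid (Fin 4)) (hc : Monotone c)
    (hsm : SingleMergeMap c) (h3 : ThreeTypes c) (e : S) : c (singleConfig e) = ⊥ := by
  have hbot := cell_bot_eq_bot c hc h3
  rcases hsm ⊥ e (config_bot_apply e) with h | ⟨i, j, hij, hm⟩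
  · rw [update_bot_eq_singleConfig] at h
    rw [← h, hbot]
  · rw [update_bot_eq_singleConfig] at hm
    exfalso
    -- `i ≠ j`, and `c {e}` relates `i` and `j`
    have hne : i ≠ j := by
      intro h; subst h; exact hij ((c ⊥).refl' i)
    have hrel : c (singleConfig e) i j := by
      rw [hm]; exact mergeBlocks_rel_self _ i j
    obtain ⟨k, -, hk⟩ := cross4_pair_unique i j hne
    -- the crossing pair of a type avoiding `k`
    have hpair : ∀ k : Fin 3, ∃ k₁ k₂ : Fin 3, k₁ ≠ k₂ ∧ k₁ ≠ k ∧ k₂ ≠ k := by decide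
    obtain ⟨k₁, k₂, h12, h1k, h2k⟩ := hpair k
    obtain ⟨ω, hω, hωc⟩ := h3 k₁ k₂ h12
    -- `e` lies in `ω` or in `ωᶜ`; in either case a crossing partition relates `i` and `j`
    cases hωe : ω e
    · have hle : singleConfig e ≤ ωᶜ := (singleConfig_le_iff e ωᶜ).2 (by simp [hωe])
      have := hc hle
      rw [hωc] at this
      have h' : cross4 k₂ i j := Setoid.le_def.1 this hrel
      exact h2k (hk k₂ h')
    · have hle : singleConfig e ≤ ω := (singleConfig_le_iff e ω).2 hωe
      have := hc hle
      rw [hω] at this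
      have h' : cross4 k₁ i j := Setoid.le_def.1 this hrel
      exact h1k (hk k₁ h')

omit [Fintype S] in
/-- **(b) Co-singletons have cell `⊤`.** -/
theorem cell_compl_singleConfig_eq_top (c : Config S → Setoid (Fin 4)) (hc : Monotone c)
    (h3 : ThreeTypes c) (e : S) : c (singleConfig e)ᶜ = ⊤ := by
  -- from each pair, the member avoiding `e` lies below `{e}ᶜ`
  have mem : ∀ k₁ k₂ : Fin 3, k₁ ≠ k₂ → ∃ k : Fin 3, (k = k₁ ∨ k = k₂) ∧ cross4 k ≤ c (singleConfig e)ᶜ := by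
    intro k₁ k₂ h12
    obtain ⟨ω, hω, hωc⟩ := h3 k₁ k₂ h12
    cases hωe : ω e
    · refine ⟨k₁, Or.inl rfl, ?_⟩
      rw [← hω]; exact hc ((le_compl_singleConfig_iff e ω).2 hωe)
    · refine ⟨k₂, Or.inr rfl, ?_⟩
      rw [← hωc]; exact hc ((le_compl_singleConfig_iff e ωᶜ).2 (by simp [hωe]))
  obtain ⟨a, ha, hale⟩ := mem 0 1 (by decide)
  obtain ⟨b, hb, hble⟩ := mem 0 2 (by decide)
  obtain ⟨d, hd, hdle⟩ := mem 1 2 (by decide)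
  -- two of `a ∈ {0,1}`, `b ∈ {0,2}`, `d ∈ {1,2}` differ
  have key : ∃ p q : Fin 3, p ≠ q ∧ cross4 p ≤ c (singleConfig e)ᶜ ∧ cross4 q ≤ c (singleConfig e)ᶜ := by
    rcases ha with rfl | rfl
    · rcases hd with rfl | rfl
      · exact ⟨0, 1, by decide, hale, hdle⟩
      · exact ⟨0, 2, by decide, hale, hdle⟩
    · rcases hb with rfl | rfl
      · exact ⟨1, 0, by decide, hale, hble⟩
      · exact ⟨1, 2, by decide, hale, hble⟩
  obtain ⟨p, q, hpq, hp, hq⟩ := key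
  apply top_le_iff.1
  calc (⊤ : Setoid (Fin 4)) = cross4 p ⊔ cross4 q := (cross4_sup_eq_top hpq).symm
    _ ≤ c (singleConfig e)ᶜ := sup_le hp hq

omit [Fintype S] in
/-- The complement of a singleton configuration is not the full configuration. -/
theorem compl_singleConfig_ne_top (e : S) : (singleConfig e)ᶜ ≠ (⊤ : Config S) := by
  intro h
  have := congrFun h e
  simp [singleConfig] at this

omit [Fintype S] in
/-- Distinct coordinates have distinct co-singleton configurations. -/
theorem compl_singleConfig_injective : Function.Injective (fun e : S => (singleConfig e)ᶜ) := by
  intro e e' h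
  have := congrFun h e
  simp [singleConfig] at this
  exact this

/-- **`|S| + 1` good pairs for free**: the co-singletons and the top configuration are `⊤`-members of
`{⊤, ⊥}` antipodal pairs. -/
theorem card_add_one_le_topBotCount (c : Config S → Setoid (Fin 4)) (hc : Monotone c)
    (hsm : SingleMergeMap c) (h3 : ThreeTypes c) :
    Fintype.card S + 1 ≤ topBotCount c := by
  classical
  rw [topBotCount_eq_card_goodSet]
  -- the co-singletons together with `⊤`
  set T : Finset (Config S) := insert ⊤ (Finset.univ.image fun e : S => (singleConfig e)ᶜ) with hT
  have hsub : T ⊆ goodSet c := by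
    intro ω hω
    rw [hT, Finset.mem_insert, Finset.mem_image] at hω
    unfold goodSet
    rw [Finset.mem_filter]
    refine ⟨Finset.mem_univ _, ?_⟩
    rcases hω with rfl | ⟨e, -, rfl⟩
    · refine ⟨?_, ?_⟩
      · -- `c ⊤ = ⊤`: above a crossing point and its antipode
        obtain ⟨ω, h1, h2⟩ := h3 0 1 (by decide)
        apply top_le_iff.1
        calc (⊤ : Setoid (Fin 4)) = cross4 0 ⊔ cross4 1 := (cross4_sup_eq_top (by decide)).symm
          _ = c ω ⊔ c ωᶜ := by rw [h1, h2]
          _ ≤ c ⊤ := sup_le (hc le_top) (hc le_top)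
      · rw [compl_top]; exact cell_bot_eq_bot c hc h3
    · refine ⟨cell_compl_singleConfig_eq_top c hc h3 e, ?_⟩
      rw [compl_compl]; exact cell_singleConfig_eq_bot c hc hsm h3 e
  have hcard : T.card = Fintype.card S + 1 := by
    rw [hT, Finset.card_insert_of_notMem, Finset.card_image_of_injective _ compl_singleConfig_injective,
      Finset.card_univ]
    rw [Finset.mem_image]
    rintro ⟨e, -, he⟩
    exact compl_singleConfig_ne_top e he
  rw [← hcard]
  exact Finset.card_le_card hsub

end SingleMerge

end PercRepro
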